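import Summits.QuantumFields.BalabanUV.T4Continuum.Spine.NE3.SlicePoincareSlicB8Flat
import Summits.QuantumFields.BalabanUV.T4Continuum.Support.NE3QbarGaugeCovariance
import Summits.QuantumFields.BalabanUV.T4Continuum.Support.NE3NestedBlockMeanCovariance
import Summits.QuantumFields.BalabanUV.T4Continuum.Support.NE3CovLiftCurl
import Summits.QuantumFields.BalabanUV.T4Continuum.Support.NE3NearIdentityGradient
import Summits.QuantumFields.BalabanUV.T4Continuum.Support.NE3CovariantBlockPoincare
import HarnessLib

/-!
# T⁴ programme, node NE3 — census R33: (P♮) ON B8's SLICE IS A GAUGE-INVARIANT CONDITION — `SlicePoincare L (j+1) W (slicB8 L N (j+1) W) C`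
# passes to every unitary periodic gauge transform `W^u` with the SAME constant (the slice, the energy and the covariant curl all dress covariantly)

Cell `pub-balaban-gaps` (track G2, seat `ne3`; writer prover-pub-balaban-gaps-ne3-g6-0, 2026-08-23), census `run/shared/lean/pub/pub-balaban-gaps/ne/NE3.md`
§4 R33 ∕ §12.  WHAT.  THE END (`PairLandauB8EndSfClassTowers.ne3EnergyRateWCov_sfClass_towers`) asks, per pair, `SlicePoincare L (j+1) W (slicB8 L N (j+1) W) CP
(periodBox (N·L^{j+1}))` at the averaged background `W = cavg L U_B` of the class ([Balaban1985BackgroundPropagators] Thm 3.3 TYPE).  THIS FILE shows the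
condition is GAUGE INVARIANT in the tower's small-field class: for unitary `W` (`LevelSmall d L j x`, `SmallField W x`) and a unitary `(N·L^{j+1})`-periodic
gauge function `u`, **`slicePoincare_slicB8_gaugeAct`** : `SlicePoincare L (j+1) W (slicB8 L N (j+1) W) C F → SlicePoincare L (j+1) (W^u) (slicB8 L N (j+1) (W^u)) C F`
(`F = periodBox (N·L^{j+1})`, same `C`).  MECHANISM: B8's slice dresses covariantly — `Y ∈ slicB8(W) ↔ Y^u ∈ slicB8(W^u)` with `Y^u = dirGauge u Y`
(`mem_slicB8_gaugeAct`): skewness by `Ad_mem_skewAdjoint`, the k-fold double-bar average by the tree's `NE3QbarGaugeCovariance.QbarIter_gaugeAct`, the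
(1.38)-Landau clause by the covariance of the test space `N(Q′(W))` (`NE3NestedBlockMeanCovariance.bmeanIterW_gaugeAct`), of the covariant site
Laplacian (`covLapSite_gaugeAct`, from `covDiv_gaugeAct` + `gaugeDir_gaugeAct`) and the `Ad`-invariance of `hsR`; the energy `dirSq` and the covariant
curl `curlSq` are invariant (`NE3NearIdentityGradient.dirSq_dirGauge`, `curlSq_gaugeAct` from `NE3CovLiftCurl.curlAt_gaugeAct` + `norm_Ad_of_unitary`).
COROLLARY (with `SlicePoincareSlicB8Flat` ∕ `SlicePoincareSlicB8FlatAllN`): (P♮) on `slicB8` holds with the flat constant at every PURE-GAUGE background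
`gaugeAct u flatCfg` on the unit torus (**`slicePoincare_slicB8_pureGauge_unit`**, constant `9·card n`; the every-`N` version follows verbatim from
`slicePoincare_slicB8_flatCfg` once that file is in the tree).

CONTENT (0 sorry, no `def`): `covDiv_gaugeAct`, `covLapSite_gaugeAct`, `curlSq_gaugeAct`, `dirGauge_inv_dirGauge`, `avgKernelGauges_gaugeAct`,
`isLandauB8_of_gaugeAct`, `mem_slicB8_of_gaugeAct`, **`slicePoincare_slicB8_gaugeAct`**, **`slicePoincare_slicB8_pureGauge_unit`** [folklore].

HONEST FRAMING.  Kinematic gauge covariance of OUR slice condition; it moves the flat non-vacuity witnesses along the gauge orbit of `W = 1` and says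
nothing about curved backgrounds or Bałaban's minimisers; (P♮) at `W = cavg L U_B` stays the printed-TYPE hypothesis; **NE3 is NOT proved**; spine
PROVED 0∕9; finite T⁴ rung (B)+1 — NOT continuum YM on ℝ⁴, NOT infinite volume, NOT mass gap, NOT Clay.
PLACEMENT: `Summits/QuantumFields/BalabanUV/T4Continuum/Spine/NE3/`.
-/

set_option autoImplicit false

open scoped BigOperators Matrix Matrix.Norms.L2Operator
open Finset

namespace Summit.QuantumFields.BalabanUV.T4Continuum.NE3.SlicePoincareSlicB8Gauge

open Literature.MathematicalPhysics.QuantumFieldTheory.Balaban1983to89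
open B7Prop1Explicit B7Prop2Explicit
open T4AveragingDeficitWall (IsUnitaryCfg IsSkewDir SmallField Ad Plane curl curlAt curlSq dirSq)
open T4AveragingDeficitWallBoundary (IsPeriodicCfg periodBox mem_periodBox)
open T4AveragingDeficitNonAbelian (Ad_mul Ad_sub)
open AveragingDeficitPeriodicCounting (IsPeriodicDir)
open AveragingDeficitMultiLevelPrep (LevelSmall)
open AveragingDeficitTransport (norm_Ad_of_unitary Ad_mem_skewAdjoint)
open AveragingDeficitNearIdentity (Ad_zero Ad_add)
open AveragingDeficitLocality (dirGauge)
open BlockAveragePushDirGauge (gaugeDir)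
open MinimalActionWitness (flatCfg isPeriodicCfg_flatCfg)
open NE3TangentCovariantTower (QbarIter)
open NE3CovariantCalculus (hsR hsR_Ad)
open NE3CovariantWeitzenbock (covDiv)
open NE3CovariantBlockMean (bmeanIterW)
open NE3NestedBlockMeanCovariance (bmeanIterW_gaugeAct)
open NE3QbarGaugeCovariance (QbarIter_gaugeAct Ad_mul_inv_Ad)
open NE3CpushGaugeCovariance (gaugeDir_gaugeAct)
open NE3CovLiftCurl (curlAt_gaugeAct)
open NE3NearIdentityGradient (dirSq_dirGauge)
open NE3CovariantBlockPoincare (Ad_inv_Ad)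
open NE3FlatHessianCurl (isUnitaryCfg_flatCfg smallField_flatCfg_zero)
open NE3SlicePoincareShape (SlicePoincare)
open NE3.PairLandauB8 (covLapSite avgKernelGauges IsLandauB8)
open NE3.LandauProjectionB8 (covDiv_gaugeDir_eq_covLapSite)
open NE3.PairLandauB8Avg (slicB8 mem_slicB8_iff)
open NE3.SlicePoincareSlicB8Flat (levelSmall_zero slicePoincare_slicB8_flatCfg_unit)

noncomputable section

variable {d : ℕ} {n : Type*} [Fintype n] [DecidableEq n]

/-! ## §1 Covariance of the covariant divergence, the covariant site Laplacian and the covariant curl energy -/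

/-- **THE COVARIANT DIVERGENCE DRESSES COVARIANTLY**: `covDiv (W^u) (ψ^u) x = Ad_{u x} (covDiv W ψ x)` (`ψ^u = dirGauge u ψ`). [folklore] -/
theorem covDiv_gaugeAct (u : Site d → (Matrix n n ℂ)ˣ) (W : Site d → Fin d → (Matrix n n ℂ)ˣ) (ψ : Site d → Fin d → Matrix n n ℂ) (x : Site d) :
    covDiv (gaugeAct u W) (dirGauge u ψ) x = Ad (u x) (covDiv W ψ x) := by
  unfold covDiv dirGauge
  have hsum : Ad (u x) (∑ μ : Fin d, (Ad (W x μ) (ψ x μ) - ψ (x - e μ) μ))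
      = ∑ μ : Fin d, (Ad (u x) (Ad (W x μ) (ψ x μ)) - Ad (u x) (ψ (x - e μ) μ)) := by
    unfold Ad
    rw [Finset.mul_sum, Finset.sum_mul]
    refine Finset.sum_congr rfl fun μ _ => ?_
    rw [mul_sub, sub_mul]
  rw [hsum]
  refine Finset.sum_congr rfl fun μ _ => ?_
  have h1 : gaugeAct u W x μ = u x * W x μ * (u (x + e μ))⁻¹ := rfl
  rw [h1, Ad_mul_inv_Ad, Ad_mul, sub_add_cancel]

/-- **THE COVARIANT SITE LAPLACIAN DRESSES COVARIANTLY**: `covLapSite (W^u) (Ad_u μ) = Ad_u ∘ covLapSite W μ`. [folklore] -/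
theorem covLapSite_gaugeAct (u : Site d → (Matrix n n ℂ)ˣ) (W : Site d → Fin d → (Matrix n n ℂ)ˣ) (mu : Site d → Matrix n n ℂ) :
    covLapSite (gaugeAct u W) (fun y => Ad (u y) (mu y)) = fun y => Ad (u y) (covLapSite W mu y) := by
  rw [← covDiv_gaugeDir_eq_covLapSite, gaugeDir_gaugeAct]
  funext y
  rw [← congrFun (covDiv_gaugeDir_eq_covLapSite W mu) y]
  exact covDiv_gaugeAct u W (gaugeDir W mu) y

/-- **THE COVARIANT CURL ENERGY IS GAUGE INVARIANT**: `curlSq (W^u) (ψ^u) F = curlSq W ψ F` for unitary `u`. [folklore] -/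
theorem curlSq_gaugeAct {u : Site d → (Matrix n n ℂ)ˣ} (hu : ∀ x, u x ∈ unitaryUnits (Matrix n n ℂ))
    (W : Site d → Fin d → (Matrix n n ℂ)ˣ) (ψ : Site d → Fin d → Matrix n n ℂ) (F : Finset (Site d)) :
    curlSq (gaugeAct u W) (dirGauge u ψ) F = curlSq W ψ F := by
  unfold curlSq curl
  refine Finset.sum_congr rfl fun z _ => Finset.sum_congr rfl fun π _ => ?_
  rw [curlAt_gaugeAct, norm_Ad_of_unitary (hu _)]

/-- Undressing and dressing: `dirGauge u (dirGauge u⁻¹ Y) = Y`. [folklore] -/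
theorem dirGauge_inv_dirGauge (u : Site d → (Matrix n n ℂ)ˣ) (Y : Site d → Fin d → Matrix n n ℂ) :
    dirGauge u (dirGauge (fun y => (u y)⁻¹) Y) = Y := by
  funext y κ
  simp only [dirGauge]
  exact NE3GaugeDirFrames.Ad_Ad_inv (u (y + e κ)) (Y y κ)

/-! ## §2 Covariance of the (1.38)-Landau clause and of B8's slice -/

section Class

variable [Nonempty n] {L N : ℕ} (hL : 2 ≤ L) (j : ℕ) {W : Site d → Fin d → (Matrix n n ℂ)ˣ} {x : ℝ}
  (hWu : IsUnitaryCfg W) (hx : 0 ≤ x) (hs : LevelSmall d L j x) (hWx : SmallField W x)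
  {u : Site d → (Matrix n n ℂ)ˣ} (hu : ∀ y, u y ∈ unitaryUnits (Matrix n n ℂ))
  (huP : ∀ (y : Site d) (τ : Fin d), u (y + ((N * L ^ (j + 1) : ℕ) : ℤ) • e τ) = u y)

include hL hWu hx hs hWx hu huP in
/-- The (1.38) test space dresses covariantly: `μ ∈ N(Q′(W)) → Ad_u μ ∈ N(Q′(W^u))`. [folklore] -/
theorem avgKernelGauges_gaugeAct {mu : Site d → Matrix n n ℂ} (hmu : mu ∈ avgKernelGauges (d := d) (n := n) L N (j + 1) W) :
    (fun y => Ad (u y) (mu y)) ∈ avgKernelGauges (d := d) (n := n) L N (j + 1) (gaugeAct u W) := by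
  have hL1 : 1 ≤ L := le_trans (by norm_num) hL
  obtain ⟨hs', hP', h0⟩ := hmu
  refine ⟨fun y => Ad_mem_skewAdjoint (hu y) (hs' y), fun y i => by simp only [huP, hP'], ?_⟩
  funext z
  rw [bmeanIterW_gaugeAct hL1 j hWu hx hs hWx hu mu z, h0]
  simp

include hL hWu hx hs hWx hu huP in
/-- **THE (1.38)-LANDAU CLAUSE UNDRESSES**: `IsLandauB8 (W^u) (Y^u) → IsLandauB8 W Y`. [folklore] -/
theorem isLandauB8_of_gaugeAct {Y : Site d → Fin d → Matrix n n ℂ}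
    (h : IsLandauB8 (d := d) L N (j + 1) (gaugeAct u W) (dirGauge u Y)) : IsLandauB8 (d := d) L N (j + 1) W Y := by
  intro mu hmu
  have h1 := h _ (avgKernelGauges_gaugeAct hL j hWu hx hs hWx hu huP hmu)
  rw [covLapSite_gaugeAct, gaugeDir_gaugeAct] at h1
  rw [← h1]
  refine Finset.sum_congr rfl fun y _ => Finset.sum_congr rfl fun κ _ => ?_
  simp only [dirGauge]
  rw [hsR_Ad (hu _)]

include hL hWu hx hs hWx hu huP in
/-- **B8's SLICE UNDRESSES**: `Y ∈ slicB8 (W^u) → Y^{u⁻¹} ∈ slicB8 W`. [folklore] -/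
theorem mem_slicB8_of_gaugeAct {Y : Site d → Fin d → Matrix n n ℂ} (hY : Y ∈ slicB8 (d := d) (n := n) L N (j + 1) (gaugeAct u W)) :
    dirGauge (fun y => (u y)⁻¹) Y ∈ slicB8 (d := d) (n := n) L N (j + 1) W := by
  have hL1 : 1 ≤ L := le_trans (by norm_num) hL
  obtain ⟨hYs, hYP, hLan, hQ⟩ := (mem_slicB8_iff (d := d) (n := n)).1 hY
  set Y₀ : Site d → Fin d → Matrix n n ℂ := dirGauge (fun y => (u y)⁻¹) Y with hY₀
  have hback : dirGauge u Y₀ = Y := dirGauge_inv_dirGauge u Y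
  have hui : ∀ y, (u y)⁻¹ ∈ unitaryUnits (Matrix n n ℂ) := fun y => (unitaryUnits (Matrix n n ℂ)).inv_mem (hu y)
  refine (mem_slicB8_iff (d := d) (n := n)).2 ⟨?_, ?_, ?_, ?_⟩
  · intro y κ; exact Ad_mem_skewAdjoint (hui _) (hYs y κ)
  · intro y τ μ
    simp only [hY₀, dirGauge]
    rw [hYP y τ μ, add_right_comm, huP]
  · rw [← hback] at hLan
    exact isLandauB8_of_gaugeAct hL j hWu hx hs hWx hu huP hLan
  · -- `QbarIter (W^u) (Y₀^u) = Ad ∘ QbarIter W Y₀` and the left side is `QbarIter (W^u) Y = 0`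
    have hcov := QbarIter_gaugeAct (d := d) (n := n) hL1 j hWu hx hs hWx hu Y₀
    have hfun : (fun y μ => Ad (u (y + e μ)) (Y₀ y μ)) = Y := by
      funext y μ; exact congrFun (congrFun hback y) μ
    rw [hfun, hQ] at hcov
    funext z κ
    have h := congrFun (congrFun hcov z) κ
    have h' := congrArg (Ad (u (((L : ℤ) ^ (j + 1)) • (z + e κ)))⁻¹) h
    rw [Ad_inv_Ad] at h'
    rw [← h']
    simp

/-! ## §3 (P♮) on B8's slice passes to every gauge transform of the background -/

include hL hWu hx hs hWx hu huP in
/-- **(P♮) ON B8's SLICE IS GAUGE INVARIANT** (module docstring): in the tower's small-field class, for a unitary `(N·L^{j+1})`-periodic gauge function `u`,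
`SlicePoincare L (j+1) W (slicB8 L N (j+1) W) C F → SlicePoincare L (j+1) (W^u) (slicB8 L N (j+1) (W^u)) C F`. [folklore] -/
theorem slicePoincare_slicB8_gaugeAct {C : ℝ} {F : Finset (Site d)}
    (h : SlicePoincare L (j + 1) W (slicB8 (d := d) (n := n) L N (j + 1) W) C F) :
    SlicePoincare L (j + 1) (gaugeAct u W) (slicB8 (d := d) (n := n) L N (j + 1) (gaugeAct u W)) C F := by
  intro Y hY
  set Y₀ : Site d → Fin d → Matrix n n ℂ := dirGauge (fun y => (u y)⁻¹) Y with hY₀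
  have hback : dirGauge u Y₀ = Y := dirGauge_inv_dirGauge u Y
  have h0 := h Y₀ (mem_slicB8_of_gaugeAct hL j hWu hx hs hWx hu huP hY)
  rw [← hback, dirSq_dirGauge hu, curlSq_gaugeAct hu]
  exact h0

end Class

/-- **(P♮) ON B8's SLICE AT EVERY PURE-GAUGE BACKGROUND ON THE UNIT TORUS, k-UNIFORM**: for `L ≥ 2`, every level `j` and every unitary
`L^{j+1}`-periodic gauge function `u`, `SlicePoincare L (j+1) (gaugeAct u flatCfg) (slicB8 L 1 (j+1) (gaugeAct u flatCfg)) (9·card n) (periodBox (1·L^{j+1}))`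
(the flat witness `slicePoincare_slicB8_flatCfg_unit` moved along the gauge orbit). [folklore] -/
theorem slicePoincare_slicB8_pureGauge_unit [Nonempty n] {L : ℕ} (hL : 2 ≤ L) (j : ℕ) {u : Site d → (Matrix n n ℂ)ˣ}
    (hu : ∀ y, u y ∈ unitaryUnits (Matrix n n ℂ)) (huP : ∀ (y : Site d) (τ : Fin d), u (y + ((1 * L ^ (j + 1) : ℕ) : ℤ) • e τ) = u y) :
    SlicePoincare L (j + 1) (gaugeAct u (flatCfg : Site d → Fin d → (Matrix n n ℂ)ˣ))
      (slicB8 (d := d) (n := n) L 1 (j + 1) (gaugeAct u (flatCfg : Site d → Fin d → (Matrix n n ℂ)ˣ)))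
      (9 * Fintype.card n) (periodBox (d := d) (1 * L ^ (j + 1))) :=
  slicePoincare_slicB8_gaugeAct hL j isUnitaryCfg_flatCfg le_rfl (levelSmall_zero hL j) smallField_flatCfg_zero hu huP
    (slicePoincare_slicB8_flatCfg_unit hL j)

end

end Summit.QuantumFields.BalabanUV.T4Continuum.NE3.SlicePoincareSlicB8Gauge
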